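import Literature.NumberTheory.ComplexMultiplication.EllipticUnits.NormCharacterArtinSymbol
import Literature.NumberTheory.ComplexMultiplication.EllipticUnits.KatoLayerRamification
import Literature.NumberTheory.LFunctions.DirichletLDerivAtZeroEven
import Literature.NumberTheory.LFunctions.DirichletLAtZero
import Mathlib.RingTheory.RootsOfUnity.AlgebraicallyClosed
import HarnessLib

/-!
# Kronecker's limit formula (15.5.1) AT THE NORM CHARACTERS `ε = ψ ∘ χ_cyc`, EVALUATED AT `s = 0`:
# `Σ_σ ε(σ) log|ι̂(σ·_𝔞z_𝔪)| = ¼·(N𝔞 − ψ(N𝔞)⁻¹)·L(0, Ψ)·Σ_a ψ(a) log|1 − ζ_m^a|` (even ψ ≠ 1, Ψ = ψ·χ_{d_K}; `L(0,Ψ) = −B_{1,Ψ}`)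
# — and the roots of unity `μ_m ⊂ K(𝔪)` on which `ε` is read; theorems only, NO named fact, NO definition

Topic `Literature/NumberTheory/ComplexMultiplication/EllipticUnits` (namespace = path).  Seat bsd-cm-k-ty1 g26 (cell bsd-cm),
SUMMON GENUS-UNIT-A5 block (A5-2) = FILE A of the ruled typing memo `G45-typing-memo.md` (c225f82434dc25c5, pen D941) steps
S1–S3.  Everything is CONDITIONAL on the one named fact F5 `Kato2004.kato1551_kroneckerLimitFormula` (hypothesis `hF5`), and
stated over ABSTRACT data (an imaginary quadratic `K` with odd discriminant, a modulus `𝔪`, a Kato unit `z`, a primitive `m`-th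
root of unity `ζ ∈ K(𝔪)`) — no `Summits` object is imported.

## What is proved

* §1 ★ `galoisLogSum_katoUnit_normCharacter_even` — THE KATO-SIDE LEVEL IDENTITY: for `K` imaginary quadratic with odd
  discriminant, `ι : K → ℂ`, a proper non-zero rigid modulus `𝔪` (`O_K^× ↪ (O_K/𝔪)^×`), `𝔞` prime to `6𝔪`, a Kato unit
  `z ∈ K(𝔪)` (`ι̂(z)^{12} = Θ(1; 𝔪, 𝔞)`), `ζ ∈ K(𝔪)` a primitive `m`-th root of unity with `supp(m) = supp(𝔪)` (the two support
  hypotheses of `NormCharacterArtinSymbol.lean`), an EVEN Dirichlet character `ψ ≠ 1` modulo `m` and an ODD `Ψ` with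
  `Ψ(n) = ψ(n)·χ_{d_K}(n)`:
  `galoisLogSum 𝔪 (ψ ∘ χ_cyc) ι̂ z = ¼ · (N𝔞 − ψ(N𝔞)⁻¹) · L(0, Ψ) · cyclotomicLogSum ψ = −¼ · (N𝔞 − ψ(N𝔞)⁻¹) · B_{1,Ψ} · cyclotomicLogSum ψ`
  — F5 in its `L′(0)`-form (`kato1551_kroneckerLimitFormula.deriv_form`) ∘ the `IsRayClassL` witness of
  `NormCharacterArtinSymbol.lean` (★★ `isRayClassL_normCharacter`: `L_{K,𝔪}(ε, s) = L(s, ψ)L(s, Ψ)`, (hε)/(hcop) discharged) ∘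
  `deriv_fun_mul` ∘ `L(0, ψ) = 0`, `L′(0, ψ) = −½·cyclotomicLogSum ψ` (`DirichletLEvenAtZero`, even `ψ ≠ 1`, any level) ∘
  `L(0, Ψ) = −B_{1,Ψ} = −(Σ_a a·Ψ(a))/M` (`LValueZero.dirichletLFunction_apply_zero_of_odd`, odd `Ψ`; the raw sum is the currency
  of the Stickelberger layers `Σ_a ψ(a)·a·(1+X)^{r(a)}`).  CONSTANTS: `−¼ = (−½)·(−½)·(−1)`
  — F5's `−½`, the regulator `−½`, the sign of `L(0, Ψ)`; the other `deriv_fun_mul` term dies with `L(0, ψ) = 0`.  The ODD-`ψ`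
  companion `galoisLogSum_katoUnit_normCharacter_even_right` (even factor on the `Ψ` side) is typed too; `…_even_eq_sum` is ★ with
  `L(0, Ψ)` evaluated (odd `Ψ`); `galoisLogSum_katoUnitRep_normCharacter_even`: the same at `𝔪 = pⁿ𝔣` for a representative
  `IsKatoUnitRep p ι 𝔣 n 𝔞 u`.
* §2 ROOTS OF UNITY IN RAY CLASS FIELDS (totally complex `K`): `adjoin_rootsOfUnity_le_rayClassField` — `K(μ_m) ⊆ K(𝔪)` whenever
  `𝔪 ≠ 0` and `𝔪 ⊆ (m)` (Neukirch VI (6.7): `(m)` is a module of definition of `K(ζ_m)|K`; the tree's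
  `le_narrowRayClassField_of_isCyclotomicExtension` + `rayClassField_eq_narrowRayClassField` + `rayClassField_mono` — the pattern
  of `KatoLayerRamification.adjoin_rootsOfUnity_le_katoLayer`, which is the case `𝔪 = p^s𝔣`, `m = p^s`); hence
  `exists_isPrimitiveRoot_rayClassField` and the ALIGNED form `exists_isPrimitiveRoot_rayClassField_map_eq`: for any injective
  ring hom `e : K̄ → L` into a domain and any primitive `m`-th root `ξ ∈ L`, there is a primitive `m`-th root `ζ ∈ K(𝔪)` with
  `e ζ = ξ` (this choice is where the consumer's «torsor coordinate» is fixed, memo S1).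
* §3 THE SUPPORT BOOKKEEPING AT KATO'S MODULI `𝔪 = p^{n+1}𝔣`, `m = p^{n+1}·d` when `𝔣 ⊆ (d)` and `(p·d) ⊆ 𝔣`:
  `katoModulus_succ_le_span` (`p^{n+1}𝔣 ⊆ (p^{n+1}d)`), `katoModulus_succ_ne_top`, `dvd_katoModulus_succ_of_mem` ((hm𝔪):
  a prime containing `p^{n+1}d` divides `p^{n+1}𝔣`), `not_coprime_absNorm_of_dvd_katoModulus_succ` ((h𝔪m): a prime dividing
  `p^{n+1}𝔣` has norm not prime to `p^{n+1}d`), and the assembled ★ `galoisLogSum_katoUnitRep_even_of_le_span` with those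
  hypotheses discharged.

For the genus road (crux `EllipticUnitValueSevenOfGZK` = stmt-BirchSwinnertonDyer-19945, K1ᵘ input (5)-unit): `K = ℚ(√−7)`,
`p = 7`, `𝔣 = 𝔭·(D)` (so `𝔣 ⊆ (|D|)`, `(7|D|) ⊆ 𝔣`), `m = 7^{n+1}|D|`, `ψ = conj(η₁κ)`; the value pin's `e : K̄ → ℚ̄` and
`F.ζsys n` give the aligned `ζₙ` by §2.  HONEST LABEL: conditional theorems (on F5); nothing here concerns an elliptic curve
over `ℚ` or BSD; no summit statement is proved; 19945 stays OPEN.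

## References
* K. Kato, Astérisque 295 (2004) §15.5 (15.5.1) (p. 253) [Kato2004Asterisque] — through F5 `kato1551_kroneckerLimitFormula`
  (constant `−½`, de Shalit II.5.1 (1)).
* J. Neukirch, *Algebraic Number Theory* (1999), Ch. VI §6 Prop. (6.7) (proof, p. 399: `(m)` is a module of definition of
  `K(ζ_m)|K`), Ch. VII §10 (10.4)(iv)–(10.5). [NeukirchANT1999]
* S. Lang, *Cyclotomic Fields I–II* (1990) Ch. 3 §5 (`L′(0, χ)` and `Σ χ(a) log|1 − ζ^a|`) [Lang1990]; F. Diamond, J. Shurman,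
  *A First Course in Modular Forms* (2005) §4.7 (`B_{1,χ}`, `L(0, χ)`) [DiamondShurman2005].
* Tree: `KroneckerLimitFormula.lean` (F5, `deriv_form`, `at_katoLayer`, `galoisLogSum`, `IsKatoUnit`), `NormCharacterArtinSymbol.lean`
  (p784195), `RayClassLOfNormCharacter.lean` (p783560), `LFunctions/DirichletLDerivAtZeroEven.lean` (p783191),
  `LFunctions/DirichletLAtZero.lean` (`LValueZero.dirichletLFunction_apply_zero_of_odd`),
  `KatoLayerRamification.lean`, `NumberFields/RayClassFieldsOfRat.lean`, `RayClassFieldGaloisGroup.lean`; memo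
  `pub/bsd-cm/bsd-cm-k-ty1/g26/G45-typing-memo.md` S1–S3.
-/

noncomputable section

open scoped NumberField
open Filter IsDedekindDomain NumberField
open Literature.NumberTheory.NumberFields (rayClassField rayUnitIdeles rayClassField_mono
  le_narrowRayClassField_of_isCyclotomicExtension rayClassField_eq_narrowRayClassField
  isCyclotomicExtension_adjoin_setOf_pow_eq_one)
open Literature.NumberTheory.EllipticCurves (IsImaginaryQuadratic)
open Literature.NumberTheory.QuadraticFields (jacobiChar)
open Literature.NumberTheory.IwasawaTheory.CyclotomicUnits (cyclotomicLogSum)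
open Literature.NumberTheory.LFunctions (LValueZero.dirichletLFunction_apply_zero_of_odd)

namespace Literature.NumberTheory.ComplexMultiplication.EllipticUnits

variable {K : Type} [Field K] [NumberField K]

/-! ## §1 F5 at the norm characters, evaluated at `s = 0` -/

section KatoSide

variable {𝔪 : Ideal (𝓞 K)} {m : ℕ} [NeZero m] {ζ : rayClassField K 𝔪}

/-- An odd Dirichlet character is non-trivial (`Ψ(−1) = −1 ≠ 1`). [cite: DiamondShurman2005, §4.7 (p. 135)] -/
theorem ne_one_of_odd {M : ℕ} {Ψ : DirichletCharacter ℂ M} (hΨ : Ψ.Odd) : Ψ ≠ 1 := by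
  rintro rfl
  have h : ((1 : DirichletCharacter ℂ M) (-1) : ℂ) = -1 := hΨ
  rw [MulChar.one_apply (isUnit_one.neg)] at h
  norm_num at h

omit [NumberField K] in
/-- An admissible twist (prime to `6𝔪`) is prime to `𝔪`. [cite: Kato2004Asterisque, §15.5 (p. 253, «𝔞 prime to 6𝔣»)] -/
theorem isCoprime_of_isCoprime_span_six_mul {𝔞 𝔪 : Ideal (𝓞 K)}
    (h𝔞 : IsCoprime 𝔞 (Ideal.span {(6 : 𝓞 K)} * 𝔪)) : IsCoprime 𝔞 𝔪 :=
  h𝔞.of_mul_right_right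

/-- **`d/ds [L(s, ψ)·L(s, Ψ)]_{s=0} = −½·cyclotomicLogSum ψ · L(0, Ψ)` for EVEN `ψ ≠ 1` and any `Ψ ≠ 1`** (`L(0, ψ) = 0`,
`L′(0, ψ) = −½ Σ_a ψ(a) log|1 − ζ^a|`). [cite: Lang1990, Ch. 3 §5 (PDF pp. 70–72)] -/
theorem deriv_LFunction_mul_LFunction_zero_of_even {m M : ℕ} [NeZero m] [NeZero M]
    {ψ : DirichletCharacter ℂ m} (hψe : ψ.Even) (hψ1 : ψ ≠ 1) {Ψ : DirichletCharacter ℂ M} (hΨ1 : Ψ ≠ 1) :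
    deriv (fun s => ψ.LFunction s * Ψ.LFunction s) 0 = -(1 / 2) * cyclotomicLogSum ψ * Ψ.LFunction 0 := by
  have hdψ : DifferentiableAt ℂ ψ.LFunction 0 := (DirichletCharacter.differentiable_LFunction hψ1).differentiableAt
  have hdΨ : DifferentiableAt ℂ Ψ.LFunction 0 := (DirichletCharacter.differentiable_LFunction hΨ1).differentiableAt
  rw [deriv_fun_mul hdψ hdΨ, LFunctions.DirichletLEvenAtZero.LFunction_zero_eq_zero hψe hψ1, zero_mul, add_zero,
    LFunctions.DirichletLEvenAtZero.deriv_LFunction_zero_eq_neg_half_cyclotomicLogSum hψe hψ1]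

/-- **The same with the factors swapped**: for any `ψ ≠ 1` and EVEN `Ψ ≠ 1`,
`d/ds [L(s, ψ)·L(s, Ψ)]_{s=0} = −½·L(0, ψ)·cyclotomicLogSum Ψ`. [cite: Lang1990, Ch. 3 §5 (PDF pp. 70–72)] -/
theorem deriv_LFunction_mul_LFunction_zero_of_even_right {m M : ℕ} [NeZero m] [NeZero M]
    {ψ : DirichletCharacter ℂ m} (hψ1 : ψ ≠ 1) {Ψ : DirichletCharacter ℂ M} (hΨe : Ψ.Even) (hΨ1 : Ψ ≠ 1) :
    deriv (fun s => ψ.LFunction s * Ψ.LFunction s) 0 = -(1 / 2) * ψ.LFunction 0 * cyclotomicLogSum Ψ := by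
  have hdψ : DifferentiableAt ℂ ψ.LFunction 0 := (DirichletCharacter.differentiable_LFunction hψ1).differentiableAt
  have hdΨ : DifferentiableAt ℂ Ψ.LFunction 0 := (DirichletCharacter.differentiable_LFunction hΨ1).differentiableAt
  rw [deriv_fun_mul hdψ hdΨ, LFunctions.DirichletLEvenAtZero.LFunction_zero_eq_zero hΨe hΨ1, mul_zero, zero_add,
    LFunctions.DirichletLEvenAtZero.deriv_LFunction_zero_eq_neg_half_cyclotomicLogSum hΨe hΨ1]
  ring

/-- **`L(0, Ψ) = −(Σ_{a mod M} a·Ψ(a))/M` for an odd `Ψ`** (`= −B_{1,Ψ}`; the tree's `LValueZero.dirichletLFunction_apply_zero_of_odd`,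
re-exported here in the shape the Stickelberger layers `Σ_a ψ(a)·a·(1+X)^{r(a)}` are written in). [cite: Lang1990, Ch. 2 §2 (B_{1,χ}) and Ch. 3 §5] -/
theorem LFunction_zero_eq_neg_sum_div_of_odd {M : ℕ} [NeZero M] {Ψ : DirichletCharacter ℂ M} (hΨo : Ψ.Odd) :
    Ψ.LFunction 0 = -(∑ a : ZMod M, (a.val : ℂ) * Ψ a) / M :=
  LValueZero.dirichletLFunction_apply_zero_of_odd hΨo

/-- ★ **KRONECKER'S LIMIT FORMULA AT THE NORM CHARACTER `ε = ψ ∘ χ_cyc`, `s = 0` EVALUATED (even `ψ ≠ 1`)** — memo S3: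
for `K` imaginary quadratic with odd discriminant, `ι : K → ℂ`, a proper non-zero rigid modulus `𝔪`, `𝔞` prime to `6𝔪`, a Kato
unit `z ∈ K(𝔪)` of twist `𝔞`, a primitive `m`-th root of unity `ζ ∈ K(𝔪)` with `supp(m) ⊆ supp(𝔪)` and `supp(𝔪) ⊆ supp(m)`,
an even Dirichlet character `ψ ≠ 1` mod `m` and any `Ψ ≠ 1` with `Ψ(n) = ψ(n)χ_{d_K}(n)` (in the application `Ψ` is odd):
`Σ_{σ ∈ Gal(K(𝔪)/K)} ε(σ)·log|ι̂(σ z)| = ¼·(N𝔞 − ψ(N𝔞)⁻¹)·L(0, Ψ)·Σ_{a ∈ (ℤ/m)ˣ} ψ(a) log|1 − e^{2πia/m}|` (and `L(0, Ψ) = −B_{1,Ψ}` for odd `Ψ`: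
`…_eq_sum`).  CONDITIONAL on F5.  [cite: Kato2004Asterisque, §15.5 (15.5.1) (p. 253)] [cite: NeukirchANT1999, Ch. VII §10 (10.4) Proposition (iv)]
[cite: Lang1990, Ch. 3 §5 (PDF pp. 70–72)] -/
theorem galoisLogSum_katoUnit_normCharacter_even (hF5 : Kato2004.kato1551_kroneckerLimitFormula)
    (hK : IsImaginaryQuadratic K) (hodd : Odd (NumberField.discr K)) (ι : K →+* ℂ)
    (h𝔪0 : 𝔪 ≠ ⊥) (h𝔪1 : 𝔪 ≠ ⊤) (hinj : UnitsInjectiveMod 𝔪)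
    {𝔞 : Ideal (𝓞 K)} (h𝔞 : IsCoprime 𝔞 (Ideal.span {(6 : 𝓞 K)} * 𝔪))
    {z : AlgebraicClosure K} (hz : z ∈ rayClassField K 𝔪) (hzu : IsKatoUnit ι 𝔪 𝔞 z)
    (hζ : IsPrimitiveRoot ζ m)
    (hm𝔪 : ∀ v : HeightOneSpectrum (𝓞 K), (m : 𝓞 K) ∈ v.asIdeal → v.asIdeal ∣ 𝔪)
    (h𝔪m : ∀ v : HeightOneSpectrum (𝓞 K), v.asIdeal ∣ 𝔪 → ¬ (Ideal.absNorm v.asIdeal).Coprime m)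
    (ψ : DirichletCharacter ℂ m) (hψe : ψ.Even) (hψ1 : ψ ≠ 1)
    {M : ℕ} [NeZero M] (Ψ : DirichletCharacter ℂ M)
    (hΨ : ∀ n : ℕ, Ψ n = ψ n * jacobiChar (NumberField.discr K).natAbs n) (hΨ1 : Ψ ≠ 1) :
    galoisLogSum 𝔪 (ψ.toUnitHom.comp (hζ.autToPow K)) (algClosureEmb ι) ⟨z, hz⟩ =
      (1 / 4) * (((Ideal.absNorm 𝔞 : ℕ) : ℂ) - (ψ (Ideal.absNorm 𝔞))⁻¹) * Ψ.LFunction 0 * cyclotomicLogSum ψ := by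
  have hL := isRayClassL_normCharacter hK.1 hodd hζ ψ hψ1 h𝔪1 hm𝔪 h𝔪m Ψ hΨ hΨ1
  obtain ⟨-, hsum⟩ := Kato2004.kato1551_kroneckerLimitFormula.deriv_form hF5 hK ι h𝔪0 hinj h𝔞 hz hzu _ hL
  rw [hsum, rayClassCharValue_normCharacter hζ ψ h𝔪1 hm𝔪 𝔞 (isCoprime_of_isCoprime_span_six_mul h𝔞),
    deriv_LFunction_mul_LFunction_zero_of_even hψe hψ1 hΨ1]
  ring

/-- ★ with `L(0, Ψ)` evaluated for ODD `Ψ`: `Σ_σ ε(σ)·log|ι̂(σ z)| = −¼·(N𝔞 − ψ(N𝔞)⁻¹)·((Σ_{a mod M} a·Ψ(a))/M)·cyclotomicLogSum ψ`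
(`(Σ a·Ψ(a))/M = B_{1,Ψ}`).  CONDITIONAL on F5. [cite: Kato2004Asterisque, §15.5 (15.5.1) (p. 253)] [cite: Lang1990, Ch. 3 §5 (PDF pp. 70–72)] -/
theorem galoisLogSum_katoUnit_normCharacter_even_eq_sum (hF5 : Kato2004.kato1551_kroneckerLimitFormula)
    (hK : IsImaginaryQuadratic K) (hodd : Odd (NumberField.discr K)) (ι : K →+* ℂ)
    (h𝔪0 : 𝔪 ≠ ⊥) (h𝔪1 : 𝔪 ≠ ⊤) (hinj : UnitsInjectiveMod 𝔪)
    {𝔞 : Ideal (𝓞 K)} (h𝔞 : IsCoprime 𝔞 (Ideal.span {(6 : 𝓞 K)} * 𝔪))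
    {z : AlgebraicClosure K} (hz : z ∈ rayClassField K 𝔪) (hzu : IsKatoUnit ι 𝔪 𝔞 z)
    (hζ : IsPrimitiveRoot ζ m)
    (hm𝔪 : ∀ v : HeightOneSpectrum (𝓞 K), (m : 𝓞 K) ∈ v.asIdeal → v.asIdeal ∣ 𝔪)
    (h𝔪m : ∀ v : HeightOneSpectrum (𝓞 K), v.asIdeal ∣ 𝔪 → ¬ (Ideal.absNorm v.asIdeal).Coprime m)
    (ψ : DirichletCharacter ℂ m) (hψe : ψ.Even) (hψ1 : ψ ≠ 1)
    {M : ℕ} [NeZero M] (Ψ : DirichletCharacter ℂ M)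
    (hΨ : ∀ n : ℕ, Ψ n = ψ n * jacobiChar (NumberField.discr K).natAbs n) (hΨo : Ψ.Odd) :
    galoisLogSum 𝔪 (ψ.toUnitHom.comp (hζ.autToPow K)) (algClosureEmb ι) ⟨z, hz⟩ =
      -(1 / 4) * (((Ideal.absNorm 𝔞 : ℕ) : ℂ) - (ψ (Ideal.absNorm 𝔞))⁻¹) *
        ((∑ a : ZMod M, (a.val : ℂ) * Ψ a) / M) * cyclotomicLogSum ψ := by
  rw [galoisLogSum_katoUnit_normCharacter_even hF5 hK hodd ι h𝔪0 h𝔪1 hinj h𝔞 hz hzu hζ hm𝔪 h𝔪m ψ hψe hψ1 Ψ hΨ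
    (ne_one_of_odd hΨo), LFunction_zero_eq_neg_sum_div_of_odd hΨo]
  ring

/-- **The companion with the even factor on the other side**: for `ψ ≠ 1` mod `m` (odd in the application) and EVEN `Ψ ≠ 1`
with `Ψ(n) = ψ(n)χ_{d_K}(n)`, `Σ_σ ε(σ)·log|ι̂(σ z)| = ¼·(N𝔞 − ψ(N𝔞)⁻¹)·L(0, ψ)·cyclotomicLogSum Ψ`.  CONDITIONAL on F5.
[cite: Kato2004Asterisque, §15.5 (15.5.1) (p. 253)] [cite: Lang1990, Ch. 3 §5 (PDF pp. 70–72)] -/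
theorem galoisLogSum_katoUnit_normCharacter_even_right (hF5 : Kato2004.kato1551_kroneckerLimitFormula)
    (hK : IsImaginaryQuadratic K) (hodd : Odd (NumberField.discr K)) (ι : K →+* ℂ)
    (h𝔪0 : 𝔪 ≠ ⊥) (h𝔪1 : 𝔪 ≠ ⊤) (hinj : UnitsInjectiveMod 𝔪)
    {𝔞 : Ideal (𝓞 K)} (h𝔞 : IsCoprime 𝔞 (Ideal.span {(6 : 𝓞 K)} * 𝔪))
    {z : AlgebraicClosure K} (hz : z ∈ rayClassField K 𝔪) (hzu : IsKatoUnit ι 𝔪 𝔞 z)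
    (hζ : IsPrimitiveRoot ζ m)
    (hm𝔪 : ∀ v : HeightOneSpectrum (𝓞 K), (m : 𝓞 K) ∈ v.asIdeal → v.asIdeal ∣ 𝔪)
    (h𝔪m : ∀ v : HeightOneSpectrum (𝓞 K), v.asIdeal ∣ 𝔪 → ¬ (Ideal.absNorm v.asIdeal).Coprime m)
    (ψ : DirichletCharacter ℂ m) (hψ1 : ψ ≠ 1)
    {M : ℕ} [NeZero M] (Ψ : DirichletCharacter ℂ M)
    (hΨ : ∀ n : ℕ, Ψ n = ψ n * jacobiChar (NumberField.discr K).natAbs n) (hΨe : Ψ.Even) (hΨ1 : Ψ ≠ 1) :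
    galoisLogSum 𝔪 (ψ.toUnitHom.comp (hζ.autToPow K)) (algClosureEmb ι) ⟨z, hz⟩ =
      (1 / 4) * (((Ideal.absNorm 𝔞 : ℕ) : ℂ) - (ψ (Ideal.absNorm 𝔞))⁻¹) * ψ.LFunction 0 * cyclotomicLogSum Ψ := by
  have hL := isRayClassL_normCharacter hK.1 hodd hζ ψ hψ1 h𝔪1 hm𝔪 h𝔪m Ψ hΨ hΨ1
  obtain ⟨-, hsum⟩ := Kato2004.kato1551_kroneckerLimitFormula.deriv_form hF5 hK ι h𝔪0 hinj h𝔞 hz hzu _ hL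
  rw [hsum, rayClassCharValue_normCharacter hζ ψ h𝔪1 hm𝔪 𝔞 (isCoprime_of_isCoprime_span_six_mul h𝔞),
    deriv_LFunction_mul_LFunction_zero_of_even_right hψ1 hΨe hΨ1]
  ring

end KatoSide

/-- ★ **At the layers `K(pⁿ𝔣)` of Kato's tower, for the representatives `IsKatoUnitRep p ι 𝔣 n 𝔞 u`** (even `ψ ≠ 1`):
the identity of `galoisLogSum_katoUnit_normCharacter_even` at `𝔪 = pⁿ𝔣`, `z = u` — the instance the genus road evaluates
at `𝔪 = 7^{n+1}𝔣` (memo S3).  CONDITIONAL on F5. [cite: Kato2004Asterisque, §15.5 (15.5.1) (p. 253)] -/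
theorem galoisLogSum_katoUnitRep_normCharacter_even (hF5 : Kato2004.kato1551_kroneckerLimitFormula)
    (hK : IsImaginaryQuadratic K) (hodd : Odd (NumberField.discr K)) (ι : K →+* ℂ)
    {p : ℕ} [Fact p.Prime] {𝔣 : Ideal (𝓞 K)} {n : ℕ} (h𝔪0 : katoModulus p 𝔣 n ≠ ⊥) (h𝔪1 : katoModulus p 𝔣 n ≠ ⊤)
    (hinj : UnitsInjectiveMod (katoModulus p 𝔣 n))
    {𝔞 : Ideal (𝓞 K)} (h𝔞 : IsCoprime 𝔞 (Ideal.span {(6 : 𝓞 K)} * katoModulus p 𝔣 n))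
    {u : (AlgebraicClosure K)ˣ} (hu : IsKatoUnitRep p ι 𝔣 n 𝔞 u)
    {m : ℕ} [NeZero m] {ζ : katoLayer p 𝔣 n} (hζ : IsPrimitiveRoot ζ m)
    (hm𝔪 : ∀ v : HeightOneSpectrum (𝓞 K), (m : 𝓞 K) ∈ v.asIdeal → v.asIdeal ∣ katoModulus p 𝔣 n)
    (h𝔪m : ∀ v : HeightOneSpectrum (𝓞 K), v.asIdeal ∣ katoModulus p 𝔣 n → ¬ (Ideal.absNorm v.asIdeal).Coprime m)
    (ψ : DirichletCharacter ℂ m) (hψe : ψ.Even) (hψ1 : ψ ≠ 1)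
    {M : ℕ} [NeZero M] (Ψ : DirichletCharacter ℂ M)
    (hΨ : ∀ k : ℕ, Ψ k = ψ k * jacobiChar (NumberField.discr K).natAbs k) (hΨo : Ψ.Odd) :
    galoisLogSum (katoModulus p 𝔣 n) (ψ.toUnitHom.comp (hζ.autToPow K)) (algClosureEmb ι) ⟨u, hu.isKatoUnit.2⟩ =
      -(1 / 4) * (((Ideal.absNorm 𝔞 : ℕ) : ℂ) - (ψ (Ideal.absNorm 𝔞))⁻¹) *
        ((∑ a : ZMod M, (a.val : ℂ) * Ψ a) / M) * cyclotomicLogSum ψ :=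
  galoisLogSum_katoUnit_normCharacter_even_eq_sum hF5 hK hodd ι h𝔪0 h𝔪1 hinj h𝔞 hu.isKatoUnit.2 hu.isKatoUnit.1 hζ
    hm𝔪 h𝔪m ψ hψe hψ1 Ψ hΨ hΨo

/-! ## §2 Roots of unity in ray class fields of a totally complex `K` (Neukirch VI (6.7)) -/

section RootsOfUnity

/-- **`K(μ_m) ⊆ K(𝔪)` for a totally complex `K`, `𝔪 ≠ 0`, `𝔪 ⊆ (m)`**: `(m)` is a module of definition of `K(ζ_m)|K`
(Neukirch VI (6.7), proof), Neukirch's `K^{(m)}` is the tree's `rayClassField` when `K` has no real place, and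
`C_{(m)} ⊆ C_𝔪`.  (The case `𝔪 = p^s𝔣`, `m = p^s` is `adjoin_rootsOfUnity_le_katoLayer`.)
[cite: NeukirchANT1999, Ch. VI §6 Prop. (6.7) (proof) p. 399] -/
theorem adjoin_rootsOfUnity_le_rayClassField [IsTotallyComplex K] {m : ℕ} [NeZero m] {𝔪 : Ideal (𝓞 K)}
    (h𝔪0 : 𝔪 ≠ ⊥) (h𝔪 : 𝔪 ≤ Ideal.span {(m : 𝓞 K)}) :
    IntermediateField.adjoin K {ζ : AlgebraicClosure K | ζ ^ m = 1} ≤ rayClassField K 𝔪 := by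
  haveI := isCyclotomicExtension_adjoin_setOf_pow_eq_one (K := K) m
  have hm : (Ideal.span {(m : 𝓞 K)} : Ideal (𝓞 K)) ≠ ⊥ := fun h => h𝔪0 (le_bot_iff.mp (h𝔪.trans h.le))
  have h1 := le_narrowRayClassField_of_isCyclotomicExtension (K := K) m
    (IntermediateField.adjoin K {ζ : AlgebraicClosure K | ζ ^ m = 1}) hm
  rw [← rayClassField_eq_narrowRayClassField hm] at h1
  exact h1.trans (rayClassField_mono (rayUnitIdeles_anti_of_le h𝔪0 h𝔪))

/-- **`μ_m ⊂ K(𝔪)`** (totally complex `K`, `𝔪 ≠ 0`, `𝔪 ⊆ (m)`). [cite: NeukirchANT1999, Ch. VI §6 Prop. (6.7) (proof) p. 399] -/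
theorem mem_rayClassField_of_pow_eq_one [IsTotallyComplex K] {m : ℕ} [NeZero m] {𝔪 : Ideal (𝓞 K)}
    (h𝔪0 : 𝔪 ≠ ⊥) (h𝔪 : 𝔪 ≤ Ideal.span {(m : 𝓞 K)}) {ζ : AlgebraicClosure K} (hζ : ζ ^ m = 1) :
    ζ ∈ rayClassField K 𝔪 :=
  adjoin_rootsOfUnity_le_rayClassField h𝔪0 h𝔪 (IntermediateField.subset_adjoin K _ hζ)

/-- **A primitive `m`-th root of unity in `K(𝔪)` exists** (totally complex `K`, `𝔪 ≠ 0`, `𝔪 ⊆ (m)`).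
[cite: NeukirchANT1999, Ch. VI §6 Prop. (6.7) (proof) p. 399] -/
theorem exists_isPrimitiveRoot_rayClassField [IsTotallyComplex K] {m : ℕ} [NeZero m] {𝔪 : Ideal (𝓞 K)}
    (h𝔪0 : 𝔪 ≠ ⊥) (h𝔪 : 𝔪 ≤ Ideal.span {(m : 𝓞 K)}) :
    ∃ ζ : rayClassField K 𝔪, IsPrimitiveRoot ζ m := by
  haveI : NeZero (m : K) := ⟨Nat.cast_ne_zero.mpr (NeZero.ne m)⟩
  obtain ⟨ζ₀, hζ₀⟩ := HasEnoughRootsOfUnity.exists_primitiveRoot (AlgebraicClosure K) m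
  exact ⟨⟨ζ₀, mem_rayClassField_of_pow_eq_one h𝔪0 h𝔪 hζ₀.pow_eq_one⟩,
    IsPrimitiveRoot.coe_submonoidClass_iff.mp hζ₀⟩

/-- **THE ALIGNED ROOT**: for an injective ring hom `e : K̄ → L` into a domain and a primitive `m`-th root of unity `ξ ∈ L`,
there is a primitive `m`-th root `ζ ∈ K(𝔪)` with `e ζ = ξ` (totally complex `K`, `𝔪 ≠ 0`, `𝔪 ⊆ (m)`) — `e` maps a primitive
root `ζ₀ ∈ K̄` to a primitive root, of which `ξ` is a power.  The choice through which a consumer's complex/`p`-adic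
normalisations are compared (memo S1: `e ζₙ = F.ζsys n`). [cite: NeukirchANT1999, Ch. VI §6 Prop. (6.7) (proof) p. 399] -/
theorem exists_isPrimitiveRoot_rayClassField_map_eq [IsTotallyComplex K] {m : ℕ} [NeZero m] {𝔪 : Ideal (𝓞 K)}
    (h𝔪0 : 𝔪 ≠ ⊥) (h𝔪 : 𝔪 ≤ Ideal.span {(m : 𝓞 K)}) {L : Type*} [CommRing L] [IsDomain L]
    (e : AlgebraicClosure K →+* L) {ξ : L} (hξ : IsPrimitiveRoot ξ m) :
    ∃ ζ : rayClassField K 𝔪, IsPrimitiveRoot ζ m ∧ e (ζ : AlgebraicClosure K) = ξ := by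
  haveI : NeZero (m : K) := ⟨Nat.cast_ne_zero.mpr (NeZero.ne m)⟩
  obtain ⟨ζ₀, hζ₀⟩ := HasEnoughRootsOfUnity.exists_primitiveRoot (AlgebraicClosure K) m
  have he : Function.Injective e := e.injective
  have hζ₀' : IsPrimitiveRoot (e ζ₀) m := hζ₀.map_of_injective he
  obtain ⟨i, -, hi⟩ := hζ₀'.eq_pow_of_pow_eq_one hξ.pow_eq_one
  have hmem : ζ₀ ^ i ∈ rayClassField K 𝔪 :=
    mem_rayClassField_of_pow_eq_one h𝔪0 h𝔪 (by rw [← pow_mul, mul_comm, pow_mul, hζ₀.pow_eq_one, one_pow])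
  have h2 : IsPrimitiveRoot (e (ζ₀ ^ i)) m := by rw [map_pow, hi]; exact hξ
  have h3 : IsPrimitiveRoot (ζ₀ ^ i) m := IsPrimitiveRoot.of_map_of_injective h2 he
  exact ⟨⟨ζ₀ ^ i, hmem⟩, IsPrimitiveRoot.coe_submonoidClass_iff.mp h3, by rw [← hi, map_pow]⟩

end RootsOfUnity

/-! ## §3 The support bookkeeping at Kato's moduli `𝔪 = p^{n+1}𝔣`, `m = p^{n+1}·d` (`𝔣 ⊆ (d)`, `(p·d) ⊆ 𝔣`) -/

section Support

variable (p : ℕ) [Fact p.Prime] (𝔣 : Ideal (𝓞 K)) (d : ℕ)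

omit [NumberField K] [Fact p.Prime] in
/-- **`p^{n+1}𝔣 ⊆ (p^{n+1}·d)` when `𝔣 ⊆ (d)`.** [cite: Kato2004Asterisque, §15.1 (p. 250)] -/
theorem katoModulus_succ_le_span (h𝔣d : 𝔣 ≤ Ideal.span {(d : 𝓞 K)}) (n : ℕ) :
    katoModulus p 𝔣 (n + 1) ≤ Ideal.span {((p ^ (n + 1) * d : ℕ) : 𝓞 K)} := by
  rw [katoModulus, Nat.cast_mul, ← Ideal.span_singleton_mul_span_singleton, Nat.cast_pow, Ideal.span_singleton_pow]
  exact Ideal.mul_mono_right h𝔣d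

/-- **`p^{n+1}𝔣 ≠ O_K`** (`p` is not a unit of `O_K`; the `s = n + 1` case of `katoModulus_ne_top` of
`KatoUnitRepIndependence`, re-proved here to keep this file's imports light). [cite: Kato2004Asterisque, §15.1 (p. 250)] -/
private theorem katoModulus_succ_ne_top (n : ℕ) : katoModulus p 𝔣 (n + 1) ≠ ⊤ := by
  have hp : p.Prime := Fact.out
  intro h
  have hle : katoModulus p 𝔣 (n + 1) ≤ Ideal.span {((p : ℕ) : 𝓞 K)} := by
    rw [katoModulus]
    exact Ideal.mul_le_right.trans (Ideal.pow_le_self (Nat.succ_ne_zero n))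
  rw [h, top_le_iff, Ideal.span_singleton_eq_top] at hle
  have h1 := hle.map (Algebra.norm ℤ)
  rw [← map_natCast (algebraMap ℤ (𝓞 K)), Algebra.norm_algebraMap, Int.isUnit_iff_natAbs_eq, Int.natAbs_pow,
    Int.natAbs_natCast, NumberField.RingOfIntegers.rank] at h1
  exact hp.one_lt.ne' ((Nat.pow_eq_one.mp h1).resolve_right Module.finrank_pos.ne')

omit [NumberField K] [Fact p.Prime] in
/-- An admissible twist (prime to `6p𝔣`) is prime to `6·p^s𝔣` (= `IsTwist.isCoprime_six_mul_katoModulus` of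
`KatoUnitRepRubinTheta`, re-proved here to keep this file's imports light). [cite: Kato2004Asterisque, §15.6 (p. 254)] -/
private theorem isCoprime_six_mul_katoModulus_of_isTwist {𝔞 : Ideal (𝓞 K)} (h : IsTwist p 𝔣 𝔞) (s : ℕ) :
    IsCoprime 𝔞 (Ideal.span {(6 : 𝓞 K)} * katoModulus p 𝔣 s) := by
  have h6p : IsCoprime 𝔞 (Ideal.span {((6 * p : ℕ) : 𝓞 K)}) := h.isCoprime.of_mul_right_left
  have h𝔣 : IsCoprime 𝔞 𝔣 := h.isCoprime.of_mul_right_right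
  rw [Nat.cast_mul, ← Ideal.span_singleton_mul_span_singleton, Nat.cast_ofNat] at h6p
  rw [katoModulus]
  exact h6p.of_mul_right_left.mul_right ((h6p.of_mul_right_right.pow_right).mul_right h𝔣)

omit [Fact p.Prime] in
/-- **(hm𝔪) A prime containing `p^{n+1}·d` divides `p^{n+1}𝔣`** (when `𝔣 ⊆ (d)`): it contains `p` — then it contains
`(p) ⊇ p^{n+1}𝔣` — or `d` — then it contains `(d) ⊇ 𝔣 ⊇ p^{n+1}𝔣`. [cite: NeukirchANT1999, Ch. VI §1 (ideals prime to 𝔪)] -/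
theorem dvd_katoModulus_succ_of_mem (h𝔣d : 𝔣 ≤ Ideal.span {(d : 𝓞 K)}) (n : ℕ) :
    ∀ v : HeightOneSpectrum (𝓞 K), ((p ^ (n + 1) * d : ℕ) : 𝓞 K) ∈ v.asIdeal → v.asIdeal ∣ katoModulus p 𝔣 (n + 1) := by
  intro v hv
  rw [Ideal.dvd_iff_le]
  rw [Nat.cast_mul, Nat.cast_pow] at hv
  rcases v.isPrime.mem_or_mem hv with h | h
  · have hp : ((p : ℕ) : 𝓞 K) ∈ v.asIdeal := v.isPrime.mem_of_pow_mem _ h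
    rw [katoModulus, pow_succ, mul_assoc]
    refine Ideal.mul_le_left.trans (Ideal.mul_le_right.trans ((Ideal.span_singleton_le_iff_mem _).mpr hp))
  · rw [katoModulus]
    exact Ideal.mul_le_left.trans (h𝔣d.trans ((Ideal.span_singleton_le_iff_mem _).mpr h))

/-- The absolute norm of a non-zero prime `v ∋ q` (`q` a rational prime) is a positive power of `q`: in particular it is not
prime to any multiple of `q`. [cite: NeukirchANT1999, Ch. I §8 (fundamental identity)] -/
theorem not_coprime_absNorm_of_natPrime_mem {q : ℕ} (hq : q.Prime) {v : HeightOneSpectrum (𝓞 K)}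
    (hv : (q : 𝓞 K) ∈ v.asIdeal) {m : ℕ} (hqm : q ∣ m) : ¬ (Ideal.absNorm v.asIdeal).Coprime m := by
  intro hcop
  have hle : Ideal.span {(q : 𝓞 K)} ≤ v.asIdeal := (Ideal.span_singleton_le_iff_mem _).mpr hv
  have hdvd : Ideal.absNorm v.asIdeal ∣ Ideal.absNorm (Ideal.span {(q : 𝓞 K)}) := Ideal.absNorm_dvd_absNorm_of_le hle
  have hnorm : Ideal.absNorm (Ideal.span {(q : 𝓞 K)}) = q ^ Module.finrank ℤ (𝓞 K) := by
    rw [Ideal.absNorm_span_singleton, ← map_natCast (algebraMap ℤ (𝓞 K)), Algebra.norm_algebraMap, Int.natAbs_pow,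
      Int.natAbs_natCast]
  rw [hnorm] at hdvd
  obtain ⟨i, -, hi⟩ := (Nat.dvd_prime_pow hq).mp hdvd
  have hi0 : i ≠ 0 := by
    rintro rfl
    rw [pow_zero, Ideal.absNorm_eq_one_iff] at hi
    exact v.isPrime.ne_top hi
  have hqN : q ∣ Ideal.absNorm v.asIdeal := by rw [hi]; exact dvd_pow_self q hi0
  have hq1 : q ∣ 1 := by
    have h := Nat.dvd_gcd hqN hqm
    rwa [Nat.Coprime.gcd_eq_one hcop] at h
  exact hq.one_lt.ne' (Nat.dvd_one.mp hq1)

omit [NumberField K] in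
/-- A non-zero prime ideal containing (the image of) a natural number `d ≠ 0` contains one of its prime factors.
[cite: NeukirchANT1999, Ch. I §8 (prime decomposition)] -/
theorem exists_natPrime_mem_of_natCast_mem {v : HeightOneSpectrum (𝓞 K)} :
    ∀ {d : ℕ}, d ≠ 0 → (d : 𝓞 K) ∈ v.asIdeal → ∃ q : ℕ, q.Prime ∧ (q : 𝓞 K) ∈ v.asIdeal ∧ q ∣ d := by
  intro d
  induction d using Nat.recOnMul with
  | zero => intro h; exact absurd rfl h
  | one =>
    intro _ h
    rw [Nat.cast_one] at h
    exact absurd (v.asIdeal.eq_top_of_isUnit_mem h isUnit_one) v.isPrime.ne_top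
  | prime q hq => intro _ h; exact ⟨q, hq, h, dvd_rfl⟩
  | mul a b iha ihb =>
    intro hab h
    rw [Nat.cast_mul] at h
    rcases v.isPrime.mem_or_mem h with ha | hb
    · obtain ⟨q, hq, hqv, hqa⟩ := iha (fun h0 => hab (by rw [h0, zero_mul])) ha
      exact ⟨q, hq, hqv, hqa.mul_right b⟩
    · obtain ⟨q, hq, hqv, hqb⟩ := ihb (fun h0 => hab (by rw [h0, mul_zero])) hb
      exact ⟨q, hq, hqv, hqb.mul_left a⟩

/-- **(h𝔪m) A prime dividing `p^{n+1}𝔣` has norm NOT prime to `p^{n+1}·d`** (when `(p·d) ⊆ 𝔣`): it contains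
`p^{n+1}𝔣 ⊇ p^{n+1}·(p·d)`, hence `p` or a prime factor of `d`, and its norm is a power of that rational prime.
[cite: NeukirchANT1999, Ch. VII §10 (10.4) Proposition (iv) («χ(𝔭) = 0 for 𝔭 | 𝔣»)] -/
theorem not_coprime_absNorm_of_dvd_katoModulus_succ (hpd𝔣 : Ideal.span {((p * d : ℕ) : 𝓞 K)} ≤ 𝔣) (n : ℕ) :
    ∀ v : HeightOneSpectrum (𝓞 K), v.asIdeal ∣ katoModulus p 𝔣 (n + 1) →
      ¬ (Ideal.absNorm v.asIdeal).Coprime (p ^ (n + 1) * d) := by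
  intro v hv
  have hp : p.Prime := Fact.out
  have hle : katoModulus p 𝔣 (n + 1) ≤ v.asIdeal := Ideal.le_of_dvd hv
  have hmem : ((p ^ (n + 1) : ℕ) : 𝓞 K) * ((p * d : ℕ) : 𝓞 K) ∈ v.asIdeal := by
    apply hle
    rw [katoModulus, Nat.cast_pow]
    exact Ideal.mul_mem_mul (Ideal.pow_mem_pow (Ideal.mem_span_singleton_self _) _)
      (hpd𝔣 (Ideal.mem_span_singleton_self _))
  rcases v.isPrime.mem_or_mem hmem with h | h
  · rw [Nat.cast_pow] at h
    exact not_coprime_absNorm_of_natPrime_mem hp (v.isPrime.mem_of_pow_mem _ h)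
      (dvd_mul_of_dvd_left (dvd_pow_self p (Nat.succ_ne_zero n)) d)
  · rw [Nat.cast_mul] at h
    rcases v.isPrime.mem_or_mem h with h' | h'
    · exact not_coprime_absNorm_of_natPrime_mem hp h' (dvd_mul_of_dvd_left (dvd_pow_self p (Nat.succ_ne_zero n)) d)
    · -- `d ∈ v`: either `d = 0` (then `m = 0` and `¬ N v ∣ 1`-coprime reads `N v ≠ 1`) or a prime factor of `d` lies in `v`
      rcases Nat.eq_zero_or_pos d with hd0 | hdpos
      · subst hd0
        rw [mul_zero, Nat.coprime_zero_right, Ideal.absNorm_eq_one_iff]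
        exact v.isPrime.ne_top
      · obtain ⟨q, hq, hqv, hqd⟩ := exists_natPrime_mem_of_natCast_mem hdpos.ne' h'
        exact not_coprime_absNorm_of_natPrime_mem hq hqv (hqd.mul_left _)

end Support

/-! ## §4 ★ assembled at Kato's moduli: the genus road's level identity with the support hypotheses discharged -/

/-- ★ **THE LEVEL-`n` KATO-SIDE IDENTITY OF THE GENUS ROAD** (memo S3 with S1/S2's bookkeeping discharged): for `K` imaginary
quadratic with odd discriminant, `p` prime, `𝔣 ≠ 0` with `𝔣 ⊆ (d)` and `(p·d) ⊆ 𝔣`, a rigid level `p^{n+1}𝔣`, an admissible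
twist `𝔞` (`IsTwist p 𝔣 𝔞`), a representative `u` of `_𝔞z_{p^{n+1}𝔣}`, a primitive `p^{n+1}d`-th root of unity `ζ ∈ K(p^{n+1}𝔣)`
(§2), an even Dirichlet character `ψ ≠ 1` mod `p^{n+1}d` and an odd `Ψ` with `Ψ(k) = ψ(k)χ_{d_K}(k)`:
`Σ_{σ ∈ Gal(K(p^{n+1}𝔣)/K)} (ψ∘χ_cyc)(σ)·log|ι̂(σ u)| = −¼·(N𝔞 − ψ(N𝔞)⁻¹)·B_{1,Ψ}·cyclotomicLogSum ψ`.  CONDITIONAL on F5.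
[cite: Kato2004Asterisque, §15.5 (15.5.1) (p. 253)] [cite: NeukirchANT1999, Ch. VII §10 (10.4) Proposition (iv)] [cite: Lang1990, Ch. 3 §5 (PDF pp. 70–72)] -/
theorem galoisLogSum_katoUnitRep_even_of_le_span (hF5 : Kato2004.kato1551_kroneckerLimitFormula)
    (hK : IsImaginaryQuadratic K) (hodd : Odd (NumberField.discr K)) (ι : K →+* ℂ)
    {p : ℕ} [Fact p.Prime] {𝔣 : Ideal (𝓞 K)} (h𝔣0 : 𝔣 ≠ ⊥) {d : ℕ} (h𝔣d : 𝔣 ≤ Ideal.span {(d : 𝓞 K)})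
    (hpd𝔣 : Ideal.span {((p * d : ℕ) : 𝓞 K)} ≤ 𝔣) {n : ℕ} (hinj : UnitsInjectiveMod (katoModulus p 𝔣 (n + 1)))
    {𝔞 : Ideal (𝓞 K)} (h𝔞 : IsTwist p 𝔣 𝔞)
    {u : (AlgebraicClosure K)ˣ} (hu : IsKatoUnitRep p ι 𝔣 (n + 1) 𝔞 u)
    [NeZero (p ^ (n + 1) * d)] {ζ : katoLayer p 𝔣 (n + 1)} (hζ : IsPrimitiveRoot ζ (p ^ (n + 1) * d))
    (ψ : DirichletCharacter ℂ (p ^ (n + 1) * d)) (hψe : ψ.Even) (hψ1 : ψ ≠ 1)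
    {M : ℕ} [NeZero M] (Ψ : DirichletCharacter ℂ M)
    (hΨ : ∀ k : ℕ, Ψ k = ψ k * jacobiChar (NumberField.discr K).natAbs k) (hΨo : Ψ.Odd) :
    galoisLogSum (katoModulus p 𝔣 (n + 1)) (ψ.toUnitHom.comp (hζ.autToPow K)) (algClosureEmb ι)
        ⟨u, hu.isKatoUnit.2⟩ =
      -(1 / 4) * (((Ideal.absNorm 𝔞 : ℕ) : ℂ) - (ψ (Ideal.absNorm 𝔞))⁻¹) *
        ((∑ a : ZMod M, (a.val : ℂ) * Ψ a) / M) * cyclotomicLogSum ψ :=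
  galoisLogSum_katoUnitRep_normCharacter_even hF5 hK hodd ι (katoModulus_ne_bot p 𝔣 h𝔣0 (n + 1))
    (katoModulus_succ_ne_top p 𝔣 n) hinj (isCoprime_six_mul_katoModulus_of_isTwist p 𝔣 h𝔞 (n + 1)) hu hζ
    (fun v hv => dvd_katoModulus_succ_of_mem p 𝔣 d h𝔣d n v (by exact_mod_cast hv))
    (not_coprime_absNorm_of_dvd_katoModulus_succ p 𝔣 d hpd𝔣 n) ψ hψe hψ1 Ψ hΨ hΨo

/-- **The aligned root at Kato's level** (§2 at `𝔪 = p^{n+1}𝔣`, `m = p^{n+1}d`): for a totally complex `K`, `𝔣 ≠ 0`,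
`𝔣 ⊆ (d)`, an injective `e : K̄ → L` and a primitive `p^{n+1}d`-th root `ξ ∈ L`, there is a primitive `p^{n+1}d`-th root
`ζ ∈ K(p^{n+1}𝔣)` with `e ζ = ξ`. [cite: NeukirchANT1999, Ch. VI §6 Prop. (6.7) (proof) p. 399] -/
theorem exists_isPrimitiveRoot_katoLayer_map_eq [IsTotallyComplex K] {p : ℕ} [Fact p.Prime] {𝔣 : Ideal (𝓞 K)}
    (h𝔣0 : 𝔣 ≠ ⊥) {d : ℕ} (h𝔣d : 𝔣 ≤ Ideal.span {(d : 𝓞 K)}) (n : ℕ) [NeZero (p ^ (n + 1) * d)]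
    {L : Type*} [CommRing L] [IsDomain L] (e : AlgebraicClosure K →+* L) {ξ : L}
    (hξ : IsPrimitiveRoot ξ (p ^ (n + 1) * d)) :
    ∃ ζ : katoLayer p 𝔣 (n + 1), IsPrimitiveRoot ζ (p ^ (n + 1) * d) ∧ e (ζ : AlgebraicClosure K) = ξ :=
  exists_isPrimitiveRoot_rayClassField_map_eq (katoModulus_ne_bot p 𝔣 h𝔣0 (n + 1))
    (katoModulus_succ_le_span p 𝔣 d h𝔣d n) e hξ

end Literature.NumberTheory.ComplexMultiplication.EllipticUnits

end
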